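import Literature.AlgebraicTopology.SingularHomology.SphereComplement
import Literature.Topology.FourManifolds.RadialSlide
import HarnessLib

/-!
# The hemisphere triad of `Sⁿ⁺¹` and its punctured deformation retractions

Topic `Literature/AlgebraicTopology/Homotopy`. The geometric input of the Freudenthal suspension
theorem in the form of Hatcher, *Algebraic Topology* (2002), Cor. 4.24 and the proof of Thm. 4.23
(Case 1, p. 362): the unit sphere `X = Sⁿ⁺¹ ⊆ ℝⁿ⁺²` is the union of the closed upper and lower
hemispheres `C₊ = {h ≥ 0}`, `C₋ = {h ≤ 0}` (`h` = last coordinate) meeting in the equator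
`Sⁿ = {h = 0}`, each hemisphere being an `(n+1)`-cell attached to the equator; and for a point
`p` of the open upper hemisphere, `X - {p}` deformation retracts onto `C₋` and `C₊ - {p}` onto the
equator (Hatcher p. 362: "`X - P` deformation retracts onto `B`", "`X - Q` onto `A`"). This file
PROVES these facts in coordinates:

* `puncturedBallDeform c` — the radial deformation of the closed unit ball of an inner product
  space punctured at an interior point `c` onto the unit sphere (along the rays from `c`, using the
  exit distance `RadialSlide.exitDist` of the tree), continuous off `c`, fixing the sphere;
* `Hemi.hgt`, `Hemi.proj`, `Hemi.liftUp`, `Hemi.refl` — height, vertical projection to `ℝⁿ⁺¹`,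
  the graph parametrisation of the closed upper hemisphere over the closed unit ball, and the
  reflection in the equatorial hyperplane;
* `Hemi.deformUp p` — for `h(p) > 0`, a deformation of `X - {p}` into itself, the identity at time
  `0` and on `C₋`, keeping `C₊ - {p}` in `C₊ - {p}`, landing in `C₋` at time `1`, jointly continuous
  on `[0, 1] × (X - {p})`; `Hemi.deformLo q` — the mirror image for `h(q) < 0`.

Everything is proved; no named facts.

## References

* A. Hatcher, *Algebraic Topology*, CUP (2002), §4.2, Cor. 4.24 and proof of Thm. 4.23 Case 1
  (p. 362); Ch. 0 p. 2 (deformation retractions). [HatcherAT2002]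
-/

noncomputable section

open Set Function Metric Topology unitInterval
open scoped RealInnerProductSpace
open Literature.Topology.FourManifolds.RadialSlide
open Literature.AlgebraicTopology.SingularHomology.SphereComplement

namespace Literature.AlgebraicTopology.Homotopy

/-! ### The punctured ball deformation retracts onto the sphere -/

section PuncturedBall

variable {E : Type*} [NormedAddCommGroup E] [InnerProductSpace ℝ E]

/-- **Radial deformation of the punctured closed unit ball onto the unit sphere** from an interior
point `c`: `(t, v) ↦ c + ((1 - t) + t · R(v)/‖v - c‖) (v - c)`, `R(v)` the exit distance from `c`
in the direction of `v - c` (Hatcher 2002, Ch. 0: `Dⁿ - {pt}` deformation retracts onto `Sⁿ⁻¹`).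
[cite: HatcherAT2002, Ch. 0 p. 2] -/
def puncturedBallDeform (c : E) (t : ℝ) (v : E) : E :=
  c + ((1 - t) + t * (exitDist c (v - c) / ‖v - c‖)) • (v - c)

variable {c : E} (hc : ‖c‖ < 1)

omit [InnerProductSpace ℝ E] in
/-- The unit direction from `c` to `v`. [folklore] -/
theorem norm_dir_eq_one [NormedSpace ℝ E] {c v : E} (hv : v ≠ c) : ‖‖v - c‖⁻¹ • (v - c)‖ = 1 := by
  have h : ‖v - c‖ ≠ 0 := norm_ne_zero_iff.2 (sub_ne_zero.2 hv)
  rw [norm_smul, norm_inv, norm_norm, inv_mul_cancel₀ h]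

/-- The deformation in polar form around `c`: `c + ((1 - t)‖v - c‖ + t R) • u` with `u` the unit
direction and `R` the exit distance in the direction `u`. [folklore] -/
theorem puncturedBallDeform_eq {v : E} (hv : v ≠ c) (t : ℝ) :
    puncturedBallDeform c t v =
      c + ((1 - t) * ‖v - c‖ + t * exitDist c (‖v - c‖⁻¹ • (v - c))) •
        (‖v - c‖⁻¹ • (v - c)) := by
  have h : ‖v - c‖ ≠ 0 := norm_ne_zero_iff.2 (sub_ne_zero.2 hv)
  have hpos : 0 < ‖v - c‖⁻¹ := inv_pos.2 (norm_pos_iff.2 (sub_ne_zero.2 hv))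
  unfold puncturedBallDeform
  rw [exitDist_smul c (v - c) hpos, smul_smul]
  congr 1
  congr 1
  field_simp

include hc

/-- The coefficient `(1 - t)‖v - c‖ + t R` is positive for `t ∈ [0, 1]`. [folklore] -/
theorem puncturedBallDeform_coeff_pos {v : E} (hv : v ≠ c) {t : ℝ} (ht0 : 0 ≤ t) (ht1 : t ≤ 1) :
    0 < (1 - t) * ‖v - c‖ + t * exitDist c (‖v - c‖⁻¹ • (v - c)) := by
  have hR := exitDist_pos hc (norm_dir_eq_one hv)
  have hr : 0 < ‖v - c‖ := norm_pos_iff.2 (sub_ne_zero.2 hv)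
  rcases eq_or_lt_of_le ht0 with rfl | ht
  · simpa using hr
  · nlinarith

/-- The deformation never hits the puncture (`t ∈ [0, 1]`). [folklore] -/
theorem puncturedBallDeform_ne {v : E} (hv : v ≠ c) {t : ℝ} (ht0 : 0 ≤ t) (ht1 : t ≤ 1) :
    puncturedBallDeform c t v ≠ c := by
  rw [puncturedBallDeform_eq hv]
  intro h
  have h' := add_eq_left.1 h
  rw [smul_eq_zero] at h'
  rcases h' with h' | h'
  · exact (puncturedBallDeform_coeff_pos hc hv ht0 ht1).ne' h'
  · have := norm_dir_eq_one hv
    rw [h', norm_zero] at this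
    exact zero_ne_one this

omit hc in
/-- At time `0` the deformation is the identity. [folklore] -/
theorem puncturedBallDeform_zero (v : E) : puncturedBallDeform c 0 v = v := by
  unfold puncturedBallDeform; simp

omit hc in
/-- For `v` in the closed unit ball, `‖v - c‖` is at most the exit distance. [folklore] -/
theorem norm_sub_le_exitDist (hc : ‖c‖ < 1) {v : E} (hv : v ≠ c) (hv1 : ‖v‖ ≤ 1) :
    ‖v - c‖ ≤ exitDist c (‖v - c‖⁻¹ • (v - c)) := by
  rw [← norm_add_smul_le_one_iff hc (norm_dir_eq_one hv) (norm_nonneg _)]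
  have h : ‖v - c‖ ≠ 0 := norm_ne_zero_iff.2 (sub_ne_zero.2 hv)
  rw [smul_smul, mul_inv_cancel₀ h, one_smul, add_sub_cancel]
  exact hv1

/-- The deformation keeps the punctured closed ball inside the closed ball (`t ∈ [0, 1]`).
[folklore] -/
theorem norm_puncturedBallDeform_le {v : E} (hv : v ≠ c) (hv1 : ‖v‖ ≤ 1) {t : ℝ} (ht0 : 0 ≤ t)
    (ht1 : t ≤ 1) : ‖puncturedBallDeform c t v‖ ≤ 1 := by
  rw [puncturedBallDeform_eq hv,
    norm_add_smul_le_one_iff hc (norm_dir_eq_one hv)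
      (puncturedBallDeform_coeff_pos hc hv ht0 ht1).le]
  have := norm_sub_le_exitDist hc hv hv1
  nlinarith

/-- At time `1` the deformation lands on the unit sphere. [folklore] -/
theorem norm_puncturedBallDeform_one {v : E} (hv : v ≠ c) : ‖puncturedBallDeform c 1 v‖ = 1 := by
  rw [puncturedBallDeform_eq hv,
    norm_add_smul_eq_one_iff hc (norm_dir_eq_one hv)
      (puncturedBallDeform_coeff_pos hc hv zero_le_one le_rfl).le]
  ring

/-- Points of the unit sphere are fixed. [folklore] -/
theorem puncturedBallDeform_of_norm_eq_one {v : E} (hv1 : ‖v‖ = 1) (t : ℝ) :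
    puncturedBallDeform c t v = v := by
  have hv : v ≠ c := fun h => by rw [h] at hv1; exact (hc.ne hv1)
  have h : ‖v - c‖ ≠ 0 := norm_ne_zero_iff.2 (sub_ne_zero.2 hv)
  have hR : ‖v - c‖ = exitDist c (‖v - c‖⁻¹ • (v - c)) := by
    rw [← norm_add_smul_eq_one_iff hc (norm_dir_eq_one hv) (norm_nonneg _),
      smul_smul, mul_inv_cancel₀ h, one_smul, add_sub_cancel]
    exact hv1
  rw [puncturedBallDeform_eq hv, ← hR, show (1 - t) * ‖v - c‖ + t * ‖v - c‖ = ‖v - c‖ by ring,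
    smul_smul, mul_inv_cancel₀ h, one_smul, add_sub_cancel]

omit hc in
/-- The deformation is jointly continuous in `(t, v)` off the puncture: along maps `T`, `V`
continuous on `s` with `V ≠ c` on `s`, `a ↦ puncturedBallDeform c (T a) (V a)` is continuous on
`s`. [folklore] -/
theorem continuousOn_puncturedBallDeform {α : Type*} [TopologicalSpace α] (c : E) {T : α → ℝ}
    {V : α → E} {s : Set α} (hT : ContinuousOn T s) (hV : ContinuousOn V s)
    (hne : ∀ a ∈ s, V a ≠ c) :
    ContinuousOn (fun a => puncturedBallDeform c (T a) (V a)) s := by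
  unfold puncturedBallDeform
  have hsub : ContinuousOn (fun a => V a - c) s := hV.sub continuousOn_const
  have hR : ContinuousOn (fun a => exitDist c (V a - c)) s :=
    (continuousOn_exitDist c).comp hsub fun a ha => sub_ne_zero.2 (hne a ha)
  have hn : ContinuousOn (fun a => ‖V a - c‖) s := hsub.norm
  refine continuousOn_const.add (ContinuousOn.smul ?_ hsub)
  refine (continuousOn_const.sub hT).add (hT.mul (hR.div hn fun a ha => ?_))
  exact norm_ne_zero_iff.2 (sub_ne_zero.2 (hne a ha))

end PuncturedBall

/-! ### The hemisphere triad of `Sⁿ⁺¹` -/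

namespace Hemi

/-- Local notation: `𝔼 n` is the model Euclidean space `EuclideanSpace ℝ (Fin n)`. -/
local notation "𝔼 " n:arg => EuclideanSpace ℝ (Fin n)

/-- Local notation: `𝕊 n` is the unit sphere in `EuclideanSpace ℝ (Fin (n + 1))`. -/
local notation "𝕊 " n:arg => (Metric.sphere (0 : EuclideanSpace ℝ (Fin (n + 1))) 1)

variable {n : ℕ}

/-- The **height** (last coordinate) on `Sⁿ⁺¹ ⊆ ℝⁿ⁺²`. [cite: HatcherAT2002, §4.2 Cor. 4.24] -/
def hgt (x : 𝕊 (n + 1)) : ℝ := (x : 𝔼 (n + 2)) (Fin.last (n + 1))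

/-- The height is continuous. [folklore] -/
theorem continuous_hgt : Continuous (hgt : 𝕊 (n + 1) → ℝ) :=
  (PiLp.continuous_apply 2 _ (Fin.last (n + 1))).comp continuous_subtype_val

/-- The **vertical projection** `Sⁿ⁺¹ → ℝⁿ⁺¹` forgetting the height. [folklore] -/
def proj (x : 𝕊 (n + 1)) : 𝔼 (n + 1) := initE (x : 𝔼 (n + 2))

/-- The projection is continuous. [folklore] -/
theorem continuous_proj : Continuous (proj : 𝕊 (n + 1) → 𝔼 (n + 1)) :=
  continuous_initE.comp continuous_subtype_val

/-- Pythagoras on the sphere: `‖proj x‖² = 1 - h(x)²`. [folklore] -/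
theorem norm_proj_sq (x : 𝕊 (n + 1)) : ‖proj x‖ ^ 2 = 1 - hgt x ^ 2 := by
  have h := norm_sq_eq_norm_initE_sq_add (x : 𝔼 (n + 2))
  rw [norm_eq_of_mem_sphere x, one_pow] at h
  unfold proj hgt
  linarith

/-- `‖proj x‖ ≤ 1`. [folklore] -/
theorem norm_proj_le_one (x : 𝕊 (n + 1)) : ‖proj x‖ ≤ 1 := by
  have h := norm_proj_sq x
  nlinarith [norm_nonneg (proj x), sq_nonneg (hgt x)]

/-- Off the equator the projection lies in the open unit ball. [folklore] -/
theorem norm_proj_lt_one {x : 𝕊 (n + 1)} (hx : hgt x ≠ 0) : ‖proj x‖ < 1 := by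
  have h := norm_proj_sq x
  have h2 : 0 < hgt x ^ 2 := by positivity
  nlinarith [norm_nonneg (proj x)]

/-- `|h(x)| ≤ 1`. [folklore] -/
theorem hgt_sq_le_one (x : 𝕊 (n + 1)) : hgt x ^ 2 ≤ 1 := by
  have h := norm_proj_sq x
  nlinarith [norm_nonneg (proj x)]

/-- A point is its projection with its height appended. [folklore] -/
theorem snocE_proj_hgt (x : 𝕊 (n + 1)) : snocE (proj x) (hgt x) = (x : 𝔼 (n + 2)) :=
  snocE_initE (x : 𝔼 (n + 2))

/-- Radial retraction of `ℝⁿ⁺¹` onto the closed unit ball. [folklore] -/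
def clampBall (v : 𝔼 (n + 1)) : 𝔼 (n + 1) := (max 1 ‖v‖)⁻¹ • v

/-- The clamp lands in the closed unit ball. [folklore] -/
theorem norm_clampBall_le_one (v : 𝔼 (n + 1)) : ‖clampBall v‖ ≤ 1 := by
  unfold clampBall
  have h1 : (1 : ℝ) ≤ max 1 ‖v‖ := le_max_left _ _
  have hpos : 0 < max 1 ‖v‖ := by positivity
  rw [norm_smul, norm_inv, Real.norm_eq_abs, abs_of_pos hpos, inv_mul_le_iff₀ hpos, mul_one]
  exact le_max_right _ _

/-- The clamp is the identity on the closed unit ball. [folklore] -/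
theorem clampBall_of_norm_le_one {v : 𝔼 (n + 1)} (hv : ‖v‖ ≤ 1) : clampBall v = v := by
  unfold clampBall
  rw [max_eq_left hv, inv_one, one_smul]

/-- The clamp is continuous. [folklore] -/
theorem continuous_clampBall : Continuous (clampBall : 𝔼 (n + 1) → 𝔼 (n + 1)) := by
  unfold clampBall
  refine Continuous.smul (Continuous.inv₀ (continuous_const.max continuous_norm) fun v => ?_)
    continuous_id
  have : (1 : ℝ) ≤ max 1 ‖v‖ := le_max_left _ _
  positivity

/-- **The graph parametrisation of the closed upper hemisphere** over the closed unit ball,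
`v ↦ (v, √(1 - ‖v‖²))` (precomposed with the clamp so as to be defined everywhere; Hatcher 2002,
Cor. 4.24: the cone `C₊Sⁿ`). [cite: HatcherAT2002, §4.2 Cor. 4.24] -/
def liftUp (v : 𝔼 (n + 1)) : 𝕊 (n + 1) :=
  ⟨snocE (clampBall v) (√(1 - ‖clampBall v‖ ^ 2)), by
    have h1 := norm_clampBall_le_one v
    have h0 : 0 ≤ 1 - ‖clampBall v‖ ^ 2 := by nlinarith [norm_nonneg (clampBall v)]
    have h := norm_snocE_sq (clampBall v) (√(1 - ‖clampBall v‖ ^ 2))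
    rw [Real.sq_sqrt h0] at h
    rw [mem_sphere_zero_iff_norm]
    nlinarith [norm_nonneg (snocE (clampBall v) (√(1 - ‖clampBall v‖ ^ 2)))]⟩

/-- The lift is continuous. [folklore] -/
theorem continuous_liftUp : Continuous (liftUp : 𝔼 (n + 1) → 𝕊 (n + 1)) :=
  Continuous.subtype_mk (continuous_snocE.comp (continuous_clampBall.prodMk
    ((continuous_const.sub (continuous_clampBall.norm.pow 2)).sqrt))) _

/-- The height of the lift of a point of the closed ball. [folklore] -/
theorem hgt_liftUp {v : 𝔼 (n + 1)} (hv : ‖v‖ ≤ 1) : hgt (liftUp v) = √(1 - ‖v‖ ^ 2) := by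
  unfold hgt liftUp
  simp [clampBall_of_norm_le_one hv]

/-- The lift lands in the closed upper hemisphere. [folklore] -/
theorem hgt_liftUp_nonneg (v : 𝔼 (n + 1)) : 0 ≤ hgt (liftUp v) := by
  unfold hgt liftUp
  simp only [snocE_apply_last]
  exact Real.sqrt_nonneg _

/-- The projection of the lift of a point of the closed ball. [folklore] -/
theorem proj_liftUp {v : 𝔼 (n + 1)} (hv : ‖v‖ ≤ 1) : proj (liftUp v) = v := by
  unfold proj liftUp
  simp [clampBall_of_norm_le_one hv]

/-- A point of the closed upper hemisphere is the lift of its projection. [folklore] -/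
theorem liftUp_proj {x : 𝕊 (n + 1)} (hx : 0 ≤ hgt x) : liftUp (proj x) = x := by
  apply Subtype.ext
  show snocE (clampBall (proj x)) (√(1 - ‖clampBall (proj x)‖ ^ 2)) = (x : 𝔼 (n + 2))
  rw [clampBall_of_norm_le_one (norm_proj_le_one x), norm_proj_sq, sub_sub_cancel,
    Real.sqrt_sq hx, snocE_proj_hgt]

/-- Points of the closed upper hemisphere with the same projection are equal. [folklore] -/
theorem eq_of_proj_eq {x y : 𝕊 (n + 1)} (hx : 0 ≤ hgt x) (hy : 0 ≤ hgt y) (h : proj x = proj y) :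
    x = y := by
  rw [← liftUp_proj hx, ← liftUp_proj hy, h]

/-- The lift of a point of the closed ball lies on the equator iff the point is on the unit
sphere. [folklore] -/
theorem hgt_liftUp_eq_zero_iff {v : 𝔼 (n + 1)} (hv : ‖v‖ ≤ 1) : hgt (liftUp v) = 0 ↔ ‖v‖ = 1 := by
  rw [hgt_liftUp hv]
  have h0 : 0 ≤ 1 - ‖v‖ ^ 2 := by nlinarith [norm_nonneg v]
  rw [Real.sqrt_eq_zero h0]
  constructor
  · intro h; nlinarith [norm_nonneg v]
  · intro h; rw [h]; ring

/-- The lift of a point of the open ball lies in the open upper hemisphere. [folklore] -/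
theorem hgt_liftUp_pos {v : 𝔼 (n + 1)} (hv : ‖v‖ < 1) : 0 < hgt (liftUp v) := by
  rw [hgt_liftUp hv.le]
  apply Real.sqrt_pos.2
  nlinarith [norm_nonneg v]

/-- **Reflection in the equatorial hyperplane** `(v, h) ↦ (v, -h)`. [folklore] -/
def refl (x : 𝕊 (n + 1)) : 𝕊 (n + 1) :=
  ⟨snocE (proj x) (-hgt x), by
    have h := norm_snocE_sq (proj x) (-hgt x)
    rw [norm_proj_sq, neg_sq] at h
    rw [mem_sphere_zero_iff_norm]
    nlinarith [norm_nonneg (snocE (proj x) (-hgt x))]⟩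

/-- The reflection is continuous. [folklore] -/
theorem continuous_refl : Continuous (refl : 𝕊 (n + 1) → 𝕊 (n + 1)) :=
  Continuous.subtype_mk (continuous_snocE.comp (continuous_proj.prodMk continuous_hgt.neg)) _

/-- The height of the reflection. [folklore] -/
@[simp]
theorem hgt_refl (x : 𝕊 (n + 1)) : hgt (refl x) = -hgt x := by
  unfold refl; unfold hgt; simp

/-- The projection of the reflection. [folklore] -/
@[simp]
theorem proj_refl (x : 𝕊 (n + 1)) : proj (refl x) = proj x := by
  unfold refl; unfold proj; simp

/-- The reflection is an involution. [folklore] -/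
@[simp]
theorem refl_refl (x : 𝕊 (n + 1)) : refl (refl x) = x := by
  apply Subtype.ext
  show snocE (proj (refl x)) (-hgt (refl x)) = (x : 𝔼 (n + 2))
  rw [proj_refl, hgt_refl, neg_neg, snocE_proj_hgt]

/-- The reflection as a self-homeomorphism of the sphere. [folklore] -/
def reflHomeo : 𝕊 (n + 1) ≃ₜ 𝕊 (n + 1) where
  toFun := refl
  invFun := refl
  left_inv := refl_refl
  right_inv := refl_refl
  continuous_toFun := continuous_refl
  continuous_invFun := continuous_refl

/-! ### The hemispheres and the equator -/

/-- The **closed upper hemisphere** `C₊ = {h ≥ 0}` (Hatcher's `A = C₊Sⁿ`). [cite: HatcherAT2002, §4.2 Cor. 4.24] -/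
def capUp : Set (𝕊 (n + 1)) := {x | 0 ≤ hgt x}

/-- The **closed lower hemisphere** `C₋ = {h ≤ 0}` (Hatcher's `B = C₋Sⁿ`). [cite: HatcherAT2002, §4.2 Cor. 4.24] -/
def capLo : Set (𝕊 (n + 1)) := {x | hgt x ≤ 0}

/-- The **equator** `{h = 0} = C₊ ∩ C₋`, a copy of `Sⁿ`. [cite: HatcherAT2002, §4.2 Cor. 4.24] -/
def eqt : Set (𝕊 (n + 1)) := {x | hgt x = 0}

/-- Membership in the upper hemisphere. [folklore] -/
theorem mem_capUp_iff {x : 𝕊 (n + 1)} : x ∈ (capUp : Set (𝕊 (n + 1))) ↔ 0 ≤ hgt x := Iff.rfl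

/-- Membership in the lower hemisphere. [folklore] -/
theorem mem_capLo_iff {x : 𝕊 (n + 1)} : x ∈ (capLo : Set (𝕊 (n + 1))) ↔ hgt x ≤ 0 := Iff.rfl

/-- Membership in the equator. [folklore] -/
theorem mem_eqt_iff {x : 𝕊 (n + 1)} : x ∈ (eqt : Set (𝕊 (n + 1))) ↔ hgt x = 0 := Iff.rfl

/-- The equator is the intersection of the two hemispheres. [folklore] -/
theorem eqt_eq_capUp_inter_capLo : (eqt : Set (𝕊 (n + 1))) = capUp ∩ capLo := by
  ext x
  simp only [mem_eqt_iff, mem_inter_iff, mem_capUp_iff, mem_capLo_iff]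
  constructor
  · intro h; exact ⟨h.ge, h.le⟩
  · intro h; exact le_antisymm h.2 h.1

/-- The upper hemisphere is closed. [folklore] -/
theorem isClosed_capUp : IsClosed (capUp : Set (𝕊 (n + 1))) := isClosed_le continuous_const continuous_hgt

/-- The lower hemisphere is closed. [folklore] -/
theorem isClosed_capLo : IsClosed (capLo : Set (𝕊 (n + 1))) := isClosed_le continuous_hgt continuous_const

/-- The equator is closed. [folklore] -/
theorem isClosed_eqt : IsClosed (eqt : Set (𝕊 (n + 1))) := isClosed_eq continuous_hgt continuous_const

/-- On the equator the projection is a unit vector. [folklore] -/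
theorem norm_proj_eq_one {x : 𝕊 (n + 1)} (hx : hgt x = 0) : ‖proj x‖ = 1 := by
  have := norm_proj_sq x
  rw [hx] at this
  nlinarith [norm_nonneg (proj x)]

/-! ### The deformation of `Sⁿ⁺¹ - {p}` onto the lower hemisphere -/

/-- **The deformation of the punctured sphere onto the closed lower hemisphere** for a point `p`
of the open upper hemisphere: on the closed upper hemisphere, the punctured-ball deformation from
`proj p` read through the graph parametrisation; the identity on the lower hemisphere (Hatcher
2002, p. 362: "`X - P` deformation retracts onto `B`"). [cite: HatcherAT2002, §4.2, proof of Thm. 4.23 (p. 362)] -/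
def deformUp (p : 𝕊 (n + 1)) (t : ℝ) (x : 𝕊 (n + 1)) : 𝕊 (n + 1) :=
  open Classical in
  if x ∈ (capUp : Set (𝕊 (n + 1))) then liftUp (puncturedBallDeform (proj p) t (proj x)) else x

/-- The deformation on the closed upper hemisphere. [folklore] -/
theorem deformUp_of_hgt_nonneg (p : 𝕊 (n + 1)) (t : ℝ) {x : 𝕊 (n + 1)} (hx : 0 ≤ hgt x) :
    deformUp p t x = liftUp (puncturedBallDeform (proj p) t (proj x)) := by
  unfold deformUp
  split_ifs with h
  · rfl
  · exact absurd (mem_capUp_iff.2 hx) h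

/-- The deformation on the open lower hemisphere is the identity. [folklore] -/
theorem deformUp_of_hgt_neg (p : 𝕊 (n + 1)) (t : ℝ) {x : 𝕊 (n + 1)} (hx : hgt x < 0) :
    deformUp p t x = x := by
  unfold deformUp
  split_ifs with h
  · exact absurd (mem_capUp_iff.1 h) (not_le.2 hx)
  · rfl

section Up

variable {p : 𝕊 (n + 1)} (hp : 0 < hgt p)
include hp

/-- For `x ≠ p` in the closed upper hemisphere, `proj x ≠ proj p`. [folklore] -/
theorem proj_ne_proj {x : 𝕊 (n + 1)} (hx : 0 ≤ hgt x) (hxp : x ≠ p) : proj x ≠ proj p :=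
  fun h => hxp (eq_of_proj_eq hx hp.le h)

omit hp in
/-- At time `0` the deformation is the identity. [folklore] -/
theorem deformUp_zero (x : 𝕊 (n + 1)) : deformUp p 0 x = x := by
  rcases le_or_gt 0 (hgt x) with hx | hx
  · rw [deformUp_of_hgt_nonneg p 0 hx, puncturedBallDeform_zero, liftUp_proj hx]
  · exact deformUp_of_hgt_neg p 0 hx

/-- The deformation fixes the closed lower hemisphere pointwise. [folklore] -/
theorem deformUp_of_hgt_nonpos {x : 𝕊 (n + 1)} (hx : hgt x ≤ 0) (t : ℝ) : deformUp p t x = x := by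
  rcases eq_or_lt_of_le hx with h0 | hlt
  · rw [deformUp_of_hgt_nonneg p t h0.ge,
      puncturedBallDeform_of_norm_eq_one (norm_proj_lt_one hp.ne') (norm_proj_eq_one h0),
      liftUp_proj h0.ge]
  · exact deformUp_of_hgt_neg p t hlt

omit hp in
/-- The deformation keeps the closed upper hemisphere in itself. [folklore] -/
theorem hgt_deformUp_nonneg {x : 𝕊 (n + 1)} (hx : 0 ≤ hgt x) (t : ℝ) : 0 ≤ hgt (deformUp p t x) := by
  rw [deformUp_of_hgt_nonneg p t hx]
  exact hgt_liftUp_nonneg _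

/-- The deformation never hits the puncture (`t ∈ [0, 1]`). [folklore] -/
theorem deformUp_ne {x : 𝕊 (n + 1)} (hxp : x ≠ p) {t : ℝ} (ht0 : 0 ≤ t) (ht1 : t ≤ 1) :
    deformUp p t x ≠ p := by
  rcases le_or_gt 0 (hgt x) with hx | hx
  · rw [deformUp_of_hgt_nonneg p t hx]
    intro h
    have hc := norm_proj_lt_one hp.ne'
    have hne := proj_ne_proj hp hx hxp
    have h1 : ‖puncturedBallDeform (proj p) t (proj x)‖ ≤ 1 :=
      norm_puncturedBallDeform_le hc hne (norm_proj_le_one x) ht0 ht1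
    have h2 := congrArg proj h
    rw [proj_liftUp h1] at h2
    exact puncturedBallDeform_ne hc hne ht0 ht1 h2
  · rw [deformUp_of_hgt_neg p t hx]
    exact hxp

/-- At time `1` the deformation lands in the closed lower hemisphere (for `x ≠ p`). [folklore] -/
theorem hgt_deformUp_one_nonpos {x : 𝕊 (n + 1)} (hxp : x ≠ p) : hgt (deformUp p 1 x) ≤ 0 := by
  rcases le_or_gt 0 (hgt x) with hx | hx
  · rw [deformUp_of_hgt_nonneg p 1 hx]
    have hc := norm_proj_lt_one hp.ne'
    have hne := proj_ne_proj hp hx hxp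
    have h1 : ‖puncturedBallDeform (proj p) 1 (proj x)‖ = 1 := norm_puncturedBallDeform_one hc hne
    rw [(hgt_liftUp_eq_zero_iff h1.le).2 h1]
  · rw [deformUp_of_hgt_neg p 1 hx]
    exact hx.le

/-- **Joint continuity** of the deformation off the puncture: along maps `T`, `V` continuous on
`s` with `V ≠ p` on `s`, `a ↦ deformUp p (T a) (V a)` is continuous on `s` (pasting along the
equator, where both formulas are the identity). [folklore] -/
theorem continuousOn_deformUp {α : Type*} [TopologicalSpace α] {T : α → ℝ} {V : α → 𝕊 (n + 1)}
    {s : Set α} (hT : ContinuousOn T s) (hV : ContinuousOn V s) (hne : ∀ a ∈ s, V a ≠ p) :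
    ContinuousOn (fun a => deformUp p (T a) (V a)) s := by
  have hc := norm_proj_lt_one hp.ne'
  -- the upper formula is continuous on `s ∩ V⁻¹{h ≥ 0}`
  have hB : ContinuousOn (fun a => puncturedBallDeform (proj p) (T a) (proj (V a)))
      (s ∩ V ⁻¹' (capUp : Set (𝕊 (n + 1)))) :=
    continuousOn_puncturedBallDeform (proj p) (hT.mono inter_subset_left)
      ((continuous_proj.comp_continuousOn hV).mono inter_subset_left)
      fun a ha => proj_ne_proj hp (mem_capUp_iff.1 ha.2) (hne a ha.1)
  have hA : ContinuousOn (fun a => liftUp (puncturedBallDeform (proj p) (T a) (proj (V a))))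
      (s ∩ V ⁻¹' (capUp : Set (𝕊 (n + 1)))) := continuous_liftUp.comp_continuousOn hB
  -- the two relatively closed pieces `V⁻¹{h ≥ 0}` and `V⁻¹{h ≤ 0}`
  have h1 : ContinuousOn (fun a => deformUp p (T a) (V a)) (s ∩ V ⁻¹' (capUp : Set (𝕊 (n + 1)))) :=
    hA.congr fun a ha => deformUp_of_hgt_nonneg p (T a) (mem_capUp_iff.1 ha.2)
  have h2 : ContinuousOn (fun a => deformUp p (T a) (V a)) (s ∩ V ⁻¹' (capLo : Set (𝕊 (n + 1)))) :=
    (hV.mono inter_subset_left).congr fun a ha => deformUp_of_hgt_nonpos hp (mem_capLo_iff.1 ha.2) _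
  intro a ha
  have hcov : s ⊆ (s ∩ V ⁻¹' (capUp : Set (𝕊 (n + 1)))) ∪ (s ∩ V ⁻¹' (capLo : Set (𝕊 (n + 1)))) :=
    fun a ha => (le_total 0 (hgt (V a))).elim (fun h => Or.inl ⟨ha, mem_capUp_iff.2 h⟩)
      fun h => Or.inr ⟨ha, mem_capLo_iff.2 h⟩
  -- off a closed piece, the piece is invisible near `a` within `s`
  have key : ∀ (K : Set (𝕊 (n + 1))), IsClosed K → V a ∉ K →
      ContinuousWithinAt (fun a => deformUp p (T a) (V a)) (s ∩ V ⁻¹' K) a := by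
    intro K hK haK
    refine continuousWithinAt_of_notMem_closure fun hcl => ?_
    have hmem : V ⁻¹' Kᶜ ∈ 𝓝[s] a :=
      (hV a ha).preimage_mem_nhdsWithin (hK.isOpen_compl.mem_nhds haK)
    obtain ⟨u, hu, hau, hus⟩ := mem_nhdsWithin.1 hmem
    obtain ⟨b, hbu, hbs, hbK⟩ := mem_closure_iff.1 hcl u hu hau
    exact hus ⟨hbu, hbs⟩ hbK
  refine ContinuousWithinAt.mono (ContinuousWithinAt.union ?_ ?_) hcov
  · by_cases ha1 : V a ∈ (capUp : Set (𝕊 (n + 1)))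
    · exact h1 a ⟨ha, ha1⟩
    · exact key _ isClosed_capUp ha1
  · by_cases ha2 : V a ∈ (capLo : Set (𝕊 (n + 1)))
    · exact h2 a ⟨ha, ha2⟩
    · exact key _ isClosed_capLo ha2

end Up

/-! ### The mirror image: the deformation of `Sⁿ⁺¹ - {q}` onto the upper hemisphere -/

/-- The deformation of the punctured sphere onto the closed *upper* hemisphere for a point `q` of
the open lower hemisphere: the mirror image of `deformUp` (Hatcher 2002, p. 362: "`X - Q`
deformation retracts onto `A`"). [cite: HatcherAT2002, §4.2, proof of Thm. 4.23 (p. 362)] -/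
def deformLo (q : 𝕊 (n + 1)) (t : ℝ) (x : 𝕊 (n + 1)) : 𝕊 (n + 1) :=
  refl (deformUp (refl q) t (refl x))

section Lo

variable {q : 𝕊 (n + 1)} (hq : hgt q < 0)
include hq

/-- The reflected puncture lies in the open upper hemisphere. [folklore] -/
theorem hgt_refl_pos : 0 < hgt (refl q) := by rw [hgt_refl]; linarith

omit hq in
/-- At time `0` the mirror deformation is the identity. [folklore] -/
theorem deformLo_zero (x : 𝕊 (n + 1)) : deformLo q 0 x = x := by
  unfold deformLo; rw [deformUp_zero, refl_refl]

/-- The mirror deformation fixes the closed upper hemisphere pointwise. [folklore] -/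
theorem deformLo_of_hgt_nonneg {x : 𝕊 (n + 1)} (hx : 0 ≤ hgt x) (t : ℝ) : deformLo q t x = x := by
  unfold deformLo
  rw [deformUp_of_hgt_nonpos (hgt_refl_pos hq) (by rw [hgt_refl]; linarith), refl_refl]

omit hq in
/-- The mirror deformation keeps the closed lower hemisphere in itself. [folklore] -/
theorem hgt_deformLo_nonpos {x : 𝕊 (n + 1)} (hx : hgt x ≤ 0) (t : ℝ) : hgt (deformLo q t x) ≤ 0 := by
  unfold deformLo
  rw [hgt_refl, neg_nonpos]
  exact hgt_deformUp_nonneg (by rw [hgt_refl]; linarith) t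

/-- The mirror deformation never hits the puncture (`t ∈ [0, 1]`). [folklore] -/
theorem deformLo_ne {x : 𝕊 (n + 1)} (hxq : x ≠ q) {t : ℝ} (ht0 : 0 ≤ t) (ht1 : t ≤ 1) :
    deformLo q t x ≠ q := by
  unfold deformLo
  intro h
  have h' := congrArg refl h
  rw [refl_refl] at h'
  exact deformUp_ne (hgt_refl_pos hq) (fun h'' => hxq (by simpa using congrArg refl h'')) ht0 ht1 h'

/-- At time `1` the mirror deformation lands in the closed upper hemisphere (for `x ≠ q`).
[folklore] -/
theorem hgt_deformLo_one_nonneg {x : 𝕊 (n + 1)} (hxq : x ≠ q) : 0 ≤ hgt (deformLo q 1 x) := by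
  unfold deformLo
  rw [hgt_refl, neg_nonneg]
  exact hgt_deformUp_one_nonpos (hgt_refl_pos hq) fun h => hxq (by simpa using congrArg refl h)

/-- Joint continuity of the mirror deformation off the puncture, along maps `T`, `V` continuous on
`s` with `V ≠ q` on `s`. [folklore] -/
theorem continuousOn_deformLo {α : Type*} [TopologicalSpace α] {T : α → ℝ} {V : α → 𝕊 (n + 1)}
    {s : Set α} (hT : ContinuousOn T s) (hV : ContinuousOn V s) (hne : ∀ a ∈ s, V a ≠ q) :
    ContinuousOn (fun a => deformLo q (T a) (V a)) s := by
  unfold deformLo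
  refine continuous_refl.comp_continuousOn
    (continuousOn_deformUp (hgt_refl_pos hq) hT (continuous_refl.comp_continuousOn hV) fun a ha h => ?_)
  exact hne a ha (by simpa using congrArg refl h)

end Lo

/-! ### Packaged for the collar lemmas: deformations parametrised by `[0, 1]` -/

/-- `deformUp p` on `[0, 1] × Sⁿ⁺¹`. [folklore] -/
def ρUp (p : 𝕊 (n + 1)) (z : I × 𝕊 (n + 1)) : 𝕊 (n + 1) := deformUp p (z.1 : ℝ) z.2

/-- `deformLo q` on `[0, 1] × Sⁿ⁺¹`. [folklore] -/
def ρLo (q : 𝕊 (n + 1)) (z : I × 𝕊 (n + 1)) : 𝕊 (n + 1) := deformLo q (z.1 : ℝ) z.2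

/-- **`Sⁿ⁺¹ - {p}` deforms onto the closed lower hemisphere** (`h(p) > 0`): `ρUp p` is continuous
on `[0, 1] × (Sⁿ⁺¹ - {p})`, keeps `Sⁿ⁺¹ - {p}` and `C₊ - {p}` invariant, is the identity at time
`0` and on `C₋`, and lands in `C₋` at time `1` (Hatcher 2002, p. 362, "`X - P` deformation
retracts onto `B`"; Cor. 4.24, `C₊ - {p}` onto the equator). [cite: HatcherAT2002, §4.2, proof of Thm. 4.23 (p. 362)] -/
theorem ρUp_spec {p : 𝕊 (n + 1)} (hp : 0 < hgt p) :
    ContinuousOn (ρUp p) {z | z.2 ∈ ({p}ᶜ : Set (𝕊 (n + 1)))} ∧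
    (∀ (t : I) (x : 𝕊 (n + 1)), x ∈ ({p}ᶜ : Set (𝕊 (n + 1))) → ρUp p (t, x) ∈ ({p}ᶜ : Set (𝕊 (n + 1)))) ∧
    (∀ x : 𝕊 (n + 1), ρUp p (0, x) = x) ∧
    (∀ x : 𝕊 (n + 1), x ∈ ({p}ᶜ : Set (𝕊 (n + 1))) → ρUp p (1, x) ∈ (capLo : Set (𝕊 (n + 1)))) ∧
    (∀ (t : I) (x : 𝕊 (n + 1)), x ∈ (capLo : Set (𝕊 (n + 1))) → ρUp p (t, x) = x) ∧
    (∀ (t : I) (x : 𝕊 (n + 1)), 0 ≤ hgt x → 0 ≤ hgt (ρUp p (t, x))) := by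
  refine ⟨?_, fun t x hx => ?_, fun x => ?_, fun x hx => ?_, fun t x hx => ?_, fun t x hx => ?_⟩
  · exact continuousOn_deformUp hp (continuous_subtype_val.comp continuous_fst).continuousOn
      continuous_snd.continuousOn fun z hz => hz
  · exact deformUp_ne hp hx t.2.1 t.2.2
  · exact deformUp_zero x
  · exact hgt_deformUp_one_nonpos hp hx
  · exact deformUp_of_hgt_nonpos hp (mem_capLo_iff.1 hx) _
  · exact hgt_deformUp_nonneg hx _

/-- **`Sⁿ⁺¹ - {q}` deforms onto the closed upper hemisphere** (`h(q) < 0`): the mirror statement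
for `ρLo q` (Hatcher 2002, p. 362, "`X - Q` deformation retracts onto `A`").
[cite: HatcherAT2002, §4.2, proof of Thm. 4.23 (p. 362)] -/
theorem ρLo_spec {q : 𝕊 (n + 1)} (hq : hgt q < 0) :
    ContinuousOn (ρLo q) {z | z.2 ∈ ({q}ᶜ : Set (𝕊 (n + 1)))} ∧
    (∀ (t : I) (x : 𝕊 (n + 1)), x ∈ ({q}ᶜ : Set (𝕊 (n + 1))) → ρLo q (t, x) ∈ ({q}ᶜ : Set (𝕊 (n + 1)))) ∧
    (∀ x : 𝕊 (n + 1), ρLo q (0, x) = x) ∧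
    (∀ x : 𝕊 (n + 1), x ∈ ({q}ᶜ : Set (𝕊 (n + 1))) → ρLo q (1, x) ∈ (capUp : Set (𝕊 (n + 1)))) ∧
    (∀ (t : I) (x : 𝕊 (n + 1)), x ∈ (capUp : Set (𝕊 (n + 1))) → ρLo q (t, x) = x) ∧
    (∀ (t : I) (x : 𝕊 (n + 1)), hgt x ≤ 0 → hgt (ρLo q (t, x)) ≤ 0) := by
  refine ⟨?_, fun t x hx => ?_, fun x => ?_, fun x hx => ?_, fun t x hx => ?_, fun t x hx => ?_⟩
  · exact continuousOn_deformLo hq (continuous_subtype_val.comp continuous_fst).continuousOn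
      continuous_snd.continuousOn fun z hz => hz
  · exact deformLo_ne hq hx t.2.1 t.2.2
  · exact deformLo_zero x
  · exact hgt_deformLo_one_nonneg hq hx
  · exact deformLo_of_hgt_nonneg hq (mem_capUp_iff.1 hx) _
  · exact hgt_deformLo_nonpos hx _

end Hemi

end Literature.AlgebraicTopology.Homotopy
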